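import Summits.QuantumFields.YangMills.Theorems.BalabanUVNodesN18CombStepPotentialDecomposition
import Summits.QuantumFields.YangMills.Theorems.BalabanUVNodesN18CombStepC1MainTerm
import HarnessLib

/-!
# N18 (β)-transport letters: THE C¹ CANCELLED SUM AT ONE DIRECTION PAIR — main term at coefficient `L²η²∕ξ² = 1`, remainders second order

[DAGN18W3-G5 INTENT-4, file (4d)] — count-neutral helper toward K3⁸ `stmt-QuantumFields-27366` (K3⁷ `stmt-QuantumFields-20544` aside; NOT claimed, NOT closed).
YM mass gap (Clay) NOT proved by any of this; R4 closes the conditional finite-𝕋⁴ rung `BalabanLadder.UV` only.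

WHY ∕ WHAT.  With `W(c) := (iξ)⁻¹log(Ū(𝐔)(c)Ū(U)(c)⁻¹) + (η∕ξ)(Ū(U)(c)·m(c₊)·Ū(U)(c)⁻¹ − m(c₋))` (`= A′_A(c) − i∇^ξ_{U_A}l(c)` for the comb generator of record,
(3a)), the C¹ cancelled sum of FILE 7's `hrest` at a direction pair `(y, ν, μ)` is `∇^ξ_{Ū(U),ν}W(⟨·, μ⟩)(y) = ξ⁻¹(Ū(U)(y,ν)·W(c′)·Ū(U)(y,ν)⁻¹ − W(c))`, `c = ⟨y, μ⟩`,
`c′ = ⟨y + e_ν, μ⟩`.  By (4c) `W = (η∕ξ)L·Q(Ad(v)A′) + E` at `c` (gauge `v = axialT U (emb y)`) and at `c′` (gauge `v′ = axialT U (emb (y+e_ν))`), `‖E‖ ≤ R∕ξ + (η∕ξ)69ℓ²ta`;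
`Ū(U)(y,ν) = E_ν·g`, `g = v(emb(y+e_ν))`, `‖E_ν − 1‖ ≤ 17ℓt`; `g·Q(Ad(v′)A′)(c′)·g⁻¹ = Q(Ad(gv′)A′)(c′)` and `gv′ = H·v` on the two blocks of `c′` with `‖H − 1‖ ≤ (ℓ∕2)t`
((2a) `holT_gaugeU_treeWord_eq`, read on the pair-box cut-off of (4a)); and the MAIN TERM `Q(Ad(v)A′)(c′) − Q(Ad(v)A′)(c)` is `≤ L(ηa₁ + 2ta)` by (4b).  RESULT
★★ `norm_nabla_transported_comb_le`:
`‖∇^ξ_{Ū(U),ν}W(⟨·,μ⟩)(y)‖ ≤ ξ⁻¹·[(η∕ξ)·L·(68ℓ·t·a + ℓ·t·a + L·(η·a₁ + 2t·a)) + 2(R∕ξ + (η∕ξ)·69ℓ²·t·a)]` — at `ξ = Lη` the coefficient of `a₁` is `L²η²∕ξ² = 1`;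
`2R∕ξ²` is `O((ℓ∕L)²(a + ℓα₀η)²)` WITHOUT `η`-decay (the second-order remainder of the linearisation differentiated once at scale `ξ`), all other terms carry `η`.
Also `bondAvg_units_conj` (conjugation through `Q`).

0 `def`, 0 `sorry`.  References: T. Bałaban, CMP **98** (1985) [Balaban1985Averaging] (Prop. 3 (122)–(126) p.36, (62)–(63) p.28, pp.24–25); CMP **95** (1984)
[Balaban1984PropagatorsI] ((1.11) p.19); CMP **109** (1987) [Balaban1987RG1] ((0.4) p.253, (1.10)–(1.13) p.262).
-/

noncomputable section

open scoped BigOperators Matrix.Norms.L2Operator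
open NormedSpace

namespace YMDAG.N18.TransportOfRecord

open Complex (I)
open Literature.MathematicalPhysics.QuantumFieldTheory.Balaban1983to89
open Literature.MathematicalPhysics.QuantumFieldTheory.Balaban1983to89.T4Continuum
open Literature.MathematicalPhysics.QuantumFieldTheory.Balaban1983to89.BlockAveraging
open Literature.MathematicalPhysics.QuantumFieldTheory.Balaban1983to89.BlockAveragingEMLLinearised (combMean)
open Literature.MathematicalPhysics.QuantumFieldTheory.Balaban1983to89.LatticeFieldCalculus (bondAvg segSum)
open Literature.MathematicalPhysics.QuantumFieldTheory.Balaban1983to89.B12RegularSpaces111 (expI gaugeU adJ plaq plaq_eq nabla)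
open Literature.MathematicalPhysics.QuantumFieldTheory.Balaban1983to89.MatrixLog (mlog)
open Literature.MathematicalPhysics.QuantumFieldTheory.Balaban1983to89.B7Prop1Explicit (l1 U1 mem_U1 treeWord)
open Literature.MathematicalPhysics.QuantumFieldTheory.Balaban1983to89.B10Eq27TorusAxialLog (holT rel axialT axialT_self)
open Literature.MathematicalPhysics.QuantumFieldTheory.Balaban1983to89.T4TermwiseBCH (norm_units_conj_le)
open Literature.MathematicalPhysics.QuantumFieldTheory.Balaban1983to89.Node00.W1 (avgUnits)
open Summit.QuantumFields.YangMills.Theorems.Prop8Chart (emlAvgU_congr₂ norm_emlAvgU_sub_one_sub_linAvg_le)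
open YMDAG.N18.AvgPotential (bondAvg_congr₂)
open YMDAG.N18.BoxStokes (two_mul_l1_le_of_inBox)

variable {P : Params} {j : ℕ} {n : Type*} [Fintype n] [DecidableEq n] [Nonempty n]

omit [Nonempty n] in
/-- Conjugation by a fixed unit passes through the straight block mean `Q`. [cite: Balaban1984PropagatorsI, (1.11) p.19 (linearity)] -/
theorem bondAvg_units_conj (g : (Matrix n n ℂ)ˣ) (Y : PBond P j → Matrix n n ℂ) (c : PBond P (j + 1)) :
    bondAvg (fun b => (g : Matrix n n ℂ) * Y b * ((g⁻¹ : (Matrix n n ℂ)ˣ) : Matrix n n ℂ)) c =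
      (g : Matrix n n ℂ) * bondAvg Y c * ((g⁻¹ : (Matrix n n ℂ)ˣ) : Matrix n n ℂ) := by
  unfold bondAvg segSum
  have hsum : ∑ r : Fin P.d → Fin P.L, ∑ t ∈ Finset.range P.L,
      (g : Matrix n n ℂ) * Y (LatticeFieldCalculus.runBond (Site.blockSite c.src r) c.dir t) * ((g⁻¹ : (Matrix n n ℂ)ˣ) : Matrix n n ℂ) =
      (g : Matrix n n ℂ) * (∑ r : Fin P.d → Fin P.L, ∑ t ∈ Finset.range P.L, Y (LatticeFieldCalculus.runBond (Site.blockSite c.src r) c.dir t)) *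
        ((g⁻¹ : (Matrix n n ℂ)ˣ) : Matrix n n ℂ) := by
    rw [Finset.mul_sum, Finset.sum_mul]
    refine Finset.sum_congr rfl fun r _ => ?_
    rw [Finset.mul_sum, Finset.sum_mul]
  rw [hsum, mul_smul_comm, smul_mul_assoc]

/-- Splitting a conjugated difference along `W = M + E`: `‖UW′U⁻¹ − W‖ ≤ ‖UM′U⁻¹ − M‖ + ‖W′ − M′‖ + ‖W − M‖` for bi-contractive `U`. [folklore] -/
theorem norm_conj_sub_le_split {V : (Matrix n n ℂ)ˣ} (hV : V ∈ U1 (Matrix n n ℂ)) (W W' M M' : Matrix n n ℂ) {e e' m : ℝ}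
    (h1 : ‖W - M‖ ≤ e) (h2 : ‖W' - M'‖ ≤ e') (h3 : ‖(V : Matrix n n ℂ) * M' * ((V⁻¹ : (Matrix n n ℂ)ˣ) : Matrix n n ℂ) - M‖ ≤ m) :
    ‖(V : Matrix n n ℂ) * W' * ((V⁻¹ : (Matrix n n ℂ)ˣ) : Matrix n n ℂ) - W‖ ≤ m + (e' + e) := by
  have hsplit : (V : Matrix n n ℂ) * W' * ((V⁻¹ : (Matrix n n ℂ)ˣ) : Matrix n n ℂ) - W =
      ((V : Matrix n n ℂ) * M' * ((V⁻¹ : (Matrix n n ℂ)ˣ) : Matrix n n ℂ) - M) +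
        ((V : Matrix n n ℂ) * (W' - M') * ((V⁻¹ : (Matrix n n ℂ)ˣ) : Matrix n n ℂ) - (W - M)) := by noncomm_ring
  rw [hsplit]
  refine (norm_add_le _ _).trans (add_le_add h3 ((norm_sub_le _ _).trans (add_le_add ((norm_units_conj_le hV _).trans h2) h1)))

omit [Nonempty n] in
/-- Conjugation commutes with scalars: `U(s·(r·Q′))U⁻¹ − s·(r·Q) = s·(r·(UQ′U⁻¹ − Q))`. [folklore] -/
theorem conj_smul_smul_sub (V : (Matrix n n ℂ)ˣ) (s r : ℂ) (Q Q' : Matrix n n ℂ) :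
    (V : Matrix n n ℂ) * (s • (r • Q')) * ((V⁻¹ : (Matrix n n ℂ)ˣ) : Matrix n n ℂ) - s • (r • Q) =
      s • (r • ((V : Matrix n n ℂ) * Q' * ((V⁻¹ : (Matrix n n ℂ)ˣ) : Matrix n n ℂ) - Q)) := by
  simp only [mul_smul_comm, smul_mul_assoc, smul_sub]

/-- The main block: `U_A = E·g`, `‖E − 1‖ ≤ r ≤ 1∕2`, `g ∈ U1`, `‖Q′‖ ≤ a`, `‖gQ′g⁻¹ − Q₁‖ ≤ b₁`, `‖Q₁ − Q₀‖ ≤ b₂` give `‖U_A Q′ U_A⁻¹ − Q₀‖ ≤ 4ra + b₁ + b₂`. [folklore] -/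
theorem norm_conj_factor_sub_le {UA E g : (Matrix n n ℂ)ˣ} (hUA : UA = E * g) {r a b₁ b₂ : ℝ} (hE : ‖(E : Matrix n n ℂ) - 1‖ ≤ r) (hr : r ≤ 1 / 2)
    (hg : g ∈ U1 (Matrix n n ℂ)) (Q' Q₁ Q₀ : Matrix n n ℂ) (hQ' : ‖Q'‖ ≤ a)
    (hb₁ : ‖(g : Matrix n n ℂ) * Q' * ((g⁻¹ : (Matrix n n ℂ)ˣ) : Matrix n n ℂ) - Q₁‖ ≤ b₁) (hb₂ : ‖Q₁ - Q₀‖ ≤ b₂) :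
    ‖(UA : Matrix n n ℂ) * Q' * ((UA⁻¹ : (Matrix n n ℂ)ˣ) : Matrix n n ℂ) - Q₀‖ ≤ 4 * r * a + b₁ + b₂ := by
  have h3 : (UA : Matrix n n ℂ) * Q' * ((UA⁻¹ : (Matrix n n ℂ)ˣ) : Matrix n n ℂ) - Q₀ =
      ((E : Matrix n n ℂ) * ((g : Matrix n n ℂ) * Q' * ((g⁻¹ : (Matrix n n ℂ)ˣ) : Matrix n n ℂ)) * ((E⁻¹ : (Matrix n n ℂ)ˣ) : Matrix n n ℂ) -
          (g : Matrix n n ℂ) * Q' * ((g⁻¹ : (Matrix n n ℂ)ˣ) : Matrix n n ℂ)) +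
        (((g : Matrix n n ℂ) * Q' * ((g⁻¹ : (Matrix n n ℂ)ˣ) : Matrix n n ℂ) - Q₁) + (Q₁ - Q₀)) := by
    rw [hUA, mul_inv_rev, Units.val_mul, Units.val_mul]; noncomm_ring
  rw [h3]
  have hgQ : ‖(g : Matrix n n ℂ) * Q' * ((g⁻¹ : (Matrix n n ℂ)ˣ) : Matrix n n ℂ)‖ ≤ a := (norm_units_conj_le hg _).trans hQ'
  have hr0 : 0 ≤ r := (norm_nonneg _).trans hE
  have hEc := norm_conj_sub_le_of_near_one hE hr ((g : Matrix n n ℂ) * Q' * ((g⁻¹ : (Matrix n n ℂ)ˣ) : Matrix n n ℂ))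
  refine (norm_add_le _ _).trans ((add_le_add hEc ((norm_add_le _ _).trans (add_le_add hb₁ hb₂))).trans ?_)
  nlinarith [hgQ]

/-- ★★ **THE C¹ CANCELLED SUM AT ONE DIRECTION PAIR** `(y, ν, μ)` (`μ = ν` allowed; `j + 2 ≤ m + K`).  Hypotheses on the pair blocks `{y, y+e_μ, y+e_ν, y+e_μ+e_ν}`:
`𝐔 = (exp iηA′)·U`, `|A′| ≤ a`, `U ∈ U1` on their bonds; `‖∂U(p) − 1‖ ≤ α` on their plaquettes; `|∇^η_{U,ν}A′_κ(z)| ≤ a₁` for `z, z+e_ν, z+e_κ, z+e_ν+e_κ` there; `((d+4)L∕2)α ≤ t`;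
`ηa ≤ 1∕2`, `136ℓ((2ηa + t + 2ηa·t) + t) ≤ 1`; `Ū(U)(y,ν) ∈ U1`.  With `W(c) = (iξ)⁻¹log(Ū(𝐔)(c)Ū(U)(c)⁻¹) + (η∕ξ)(Ū(U)(c)m(c₊)Ū(U)(c)⁻¹ − m(c₋))`,
`m(z) = λ̄_{Ad(axialT U (emb z))A′}(z)`:  `‖∇^ξ_{Ū(U),ν}(W⟨·,μ⟩)(y)‖ ≤ ξ⁻¹·[(η∕ξ)·L·(69ℓ·t·a + L·(η·a₁ + 2t·a)) + 2·(R∕ξ + (η∕ξ)·69ℓ²·t·a)]`.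
[cite: Balaban1985Averaging, Prop. 3 (122)-(126) p.36, (62)-(63) p.28, pp.24-25; Balaban1984PropagatorsI, (1.11) p.19; Balaban1987RG1, (0.4) p.253, (1.10)-(1.13) p.262] -/
theorem norm_nabla_transported_comb_le (hj : j + 1 ≤ P.m + P.K) (hj2 : j + 2 ≤ P.m + P.K) (y : Site P (j + 1)) (μ ν : Fin P.d)
    {Uc U : GaugeField P j (Matrix n n ℂ)ˣ} {A : PBond P j → Matrix n n ℂ} {η ξ a a₁ α t : ℝ} (hη : 0 < η) (hξ : 0 < ξ) (ha0 : 0 ≤ a) (ha1 : 0 ≤ a₁)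
    (hα : 0 ≤ α)
    (hf : ∀ b : PBond P j, (blockOf b.src = y ∨ blockOf b.src = y.shift μ ∨ blockOf b.src = y.shift ν ∨ blockOf b.src = (y.shift μ).shift ν) →
      (blockOf b.tgt = y ∨ blockOf b.tgt = y.shift μ ∨ blockOf b.tgt = y.shift ν ∨ blockOf b.tgt = (y.shift μ).shift ν) → Uc b = expI η (A b) * U b)
    (hA : ∀ b : PBond P j, (blockOf b.src = y ∨ blockOf b.src = y.shift μ ∨ blockOf b.src = y.shift ν ∨ blockOf b.src = (y.shift μ).shift ν) →
      (blockOf b.tgt = y ∨ blockOf b.tgt = y.shift μ ∨ blockOf b.tgt = y.shift ν ∨ blockOf b.tgt = (y.shift μ).shift ν) → ‖A b‖ ≤ a)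
    (hηa : η * a ≤ 1 / 2)
    (hU1 : ∀ b : PBond P j, (blockOf b.src = y ∨ blockOf b.src = y.shift μ ∨ blockOf b.src = y.shift ν ∨ blockOf b.src = (y.shift μ).shift ν) →
      (blockOf b.tgt = y ∨ blockOf b.tgt = y.shift μ ∨ blockOf b.tgt = y.shift ν ∨ blockOf b.tgt = (y.shift μ).shift ν) → U b ∈ U1 (Matrix n n ℂ))
    (hplaq : ∀ p : Plaq P j, (blockOf p.src = y ∨ blockOf p.src = y.shift μ ∨ blockOf p.src = y.shift ν ∨ blockOf p.src = (y.shift μ).shift ν) →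
      (blockOf (p.src.shift p.μ) = y ∨ blockOf (p.src.shift p.μ) = y.shift μ ∨ blockOf (p.src.shift p.μ) = y.shift ν ∨
        blockOf (p.src.shift p.μ) = (y.shift μ).shift ν) →
      (blockOf (p.src.shift p.ν) = y ∨ blockOf (p.src.shift p.ν) = y.shift μ ∨ blockOf (p.src.shift p.ν) = y.shift ν ∨
        blockOf (p.src.shift p.ν) = (y.shift μ).shift ν) →
      (blockOf ((p.src.shift p.μ).shift p.ν) = y ∨ blockOf ((p.src.shift p.μ).shift p.ν) = y.shift μ ∨
        blockOf ((p.src.shift p.μ).shift p.ν) = y.shift ν ∨ blockOf ((p.src.shift p.μ).shift p.ν) = (y.shift μ).shift ν) →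
      ‖((plaq U p : (Matrix n n ℂ)ˣ) : Matrix n n ℂ) - 1‖ ≤ α)
    (hA1 : ∀ (z : Site P j) (κ : Fin P.d),
      (blockOf z = y ∨ blockOf z = y.shift μ ∨ blockOf z = y.shift ν ∨ blockOf z = (y.shift μ).shift ν) →
      (blockOf (z.shift ν) = y ∨ blockOf (z.shift ν) = y.shift μ ∨ blockOf (z.shift ν) = y.shift ν ∨ blockOf (z.shift ν) = (y.shift μ).shift ν) →
      (blockOf (z.shift κ) = y ∨ blockOf (z.shift κ) = y.shift μ ∨ blockOf (z.shift κ) = y.shift ν ∨ blockOf (z.shift κ) = (y.shift μ).shift ν) →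
      (blockOf ((z.shift ν).shift κ) = y ∨ blockOf ((z.shift ν).shift κ) = y.shift μ ∨ blockOf ((z.shift ν).shift κ) = y.shift ν ∨
        blockOf ((z.shift ν).shift κ) = (y.shift μ).shift ν) →
      ‖nabla η U ν (fun w => A ⟨w, κ⟩) z‖ ≤ a₁)
    (hRt : ((((P.d + 4) * P.L : ℕ) : ℝ) / 2) * α ≤ t)
    (hℓ : 136 * (((P.d + 2) * P.L : ℕ) : ℝ) * ((2 * (η * a) + t + 2 * (η * a) * t) + t) ≤ 1)
    (hUAν : avgUnits U ⟨y, ν⟩ ∈ U1 (Matrix n n ℂ)) :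
    ‖nabla ξ (avgUnits U) ν
        (fun w => (I * (ξ : ℂ))⁻¹ • mlog (((avgUnits Uc ⟨w, μ⟩ : (Matrix n n ℂ)ˣ) : Matrix n n ℂ) * (((avgUnits U ⟨w, μ⟩)⁻¹ : (Matrix n n ℂ)ˣ) : Matrix n n ℂ)) +
          ((η / ξ : ℝ) : ℂ) • (((avgUnits U ⟨w, μ⟩ : (Matrix n n ℂ)ˣ) : Matrix n n ℂ) * combMean (adJ (axialT U (emb (w.shift μ))) A) (w.shift μ) *
            (((avgUnits U ⟨w, μ⟩)⁻¹ : (Matrix n n ℂ)ˣ) : Matrix n n ℂ) - combMean (adJ (axialT U (emb w)) A) w)) y‖ ≤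
      ξ⁻¹ * (η / ξ * (P.L : ℝ) * (69 * (((P.d + 2) * P.L : ℕ) : ℝ) * t * a + (P.L : ℝ) * (η * a₁ + 2 * t * a)) +
        2 * ((4 * (34 * (((P.d + 2) * P.L : ℕ) : ℝ) * ((2 * (η * a) + t + 2 * (η * a) * t) + t)) ^ 2 +
          578 * (((P.d + 2) * P.L : ℕ) : ℝ) ^ 2 * ((2 * (η * a) + t + 2 * (η * a) * t) + t) * t +
          660 * (((P.d + 2) * P.L : ℕ) : ℝ) ^ 2 * ((2 * (η * a) + t + 2 * (η * a) * t) ^ 2 + t ^ 2) +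
          3 * (((P.d + 2) * P.L : ℕ) : ℝ) * (2 * (η * a) * t) + 3 * (((P.d + 2) * P.L : ℕ) : ℝ) * (η * a) ^ 2) / ξ +
          η / ξ * (69 * (((P.d + 2) * P.L : ℕ) : ℝ) ^ 2 * t * a))) := by
  classical
  have ht0 : 0 ≤ t := le_trans (by positivity) hRt
  set ℓ : ℝ := (((P.d + 2) * P.L : ℕ) : ℝ) with hℓdef
  have hℓ0 : 0 ≤ ℓ := Nat.cast_nonneg _
  have hℓ1 : 1 ≤ ℓ := by
    rw [hℓdef]; have := P.L_pos; have : 1 ≤ (P.d + 2) * P.L := Nat.one_le_iff_ne_zero.mpr (by positivity); exact_mod_cast this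
  have hℓt : 136 * ℓ * t ≤ 1 := by
    nlinarith only [hℓ, hℓ0, ht0, mul_nonneg hη.le ha0, mul_nonneg (mul_nonneg hℓ0 (mul_nonneg hη.le ha0)) ht0]
  have hRt2 : ((((P.d + 2) * P.L : ℕ) : ℝ) / 2) * α ≤ t := by
    refine le_trans (mul_le_mul_of_nonneg_right ?_ hα) hRt
    gcongr; omega
  -- names
  have hνμ : (y.shift ν).shift μ = (y.shift μ).shift ν := Site.shift_comm _ _ _
  -- membership maps: two blocks of `(⟨y, μ⟩ : PBond P (j + 1))`, of `(⟨y, μ⟩ : PBond P (j + 1))′`, of `⟨y, ν⟩` into the pair blocks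
  have incC : ∀ x : Site P j, (blockOf x = y ∨ blockOf x = (y.shift μ)) →
      (blockOf x = y ∨ blockOf x = y.shift μ ∨ blockOf x = y.shift ν ∨ blockOf x = (y.shift μ).shift ν) := fun x h => by
    rcases h with h | h
    · exact Or.inl h
    · exact Or.inr (Or.inl h)
  have incC' : ∀ x : Site P j, (blockOf x = (y.shift ν) ∨ blockOf x = ((y.shift ν).shift μ)) →
      (blockOf x = y ∨ blockOf x = y.shift μ ∨ blockOf x = y.shift ν ∨ blockOf x = (y.shift μ).shift ν) := fun x h => by
    rcases h with h | h
    · exact Or.inr (Or.inr (Or.inl h))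
    · refine Or.inr (Or.inr (Or.inr ?_)); rw [← hνμ]; exact h
  have incN : ∀ x : Site P j, (blockOf x = (⟨y, ν⟩ : PBond P (j + 1)).src ∨ blockOf x = (⟨y, ν⟩ : PBond P (j + 1)).tgt) →
      (blockOf x = y ∨ blockOf x = y.shift μ ∨ blockOf x = y.shift ν ∨ blockOf x = (y.shift μ).shift ν) := fun x h => by
    rcases h with h | h
    · exact Or.inl h
    · exact Or.inr (Or.inr (Or.inl h))
  have plaqOf : ∀ (d : PBond P (j + 1)) (inc : ∀ x : Site P j, (blockOf x = d.src ∨ blockOf x = d.tgt) →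
      (blockOf x = y ∨ blockOf x = y.shift μ ∨ blockOf x = y.shift ν ∨ blockOf x = (y.shift μ).shift ν)),
      ∀ p : Plaq P j, (blockOf p.src = d.src ∨ blockOf p.src = d.tgt) →
      (blockOf (p.src.shift p.μ) = d.src ∨ blockOf (p.src.shift p.μ) = d.tgt) →
      (blockOf (p.src.shift p.ν) = d.src ∨ blockOf (p.src.shift p.ν) = d.tgt) →
      (blockOf ((p.src.shift p.μ).shift p.ν) = d.src ∨ blockOf ((p.src.shift p.μ).shift p.ν) = d.tgt) →
      ‖((plaq U p : (Matrix n n ℂ)ˣ) : Matrix n n ℂ) - 1‖ ≤ α := fun d inc p h1 h2 h3 h4 =>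
    hplaq p (inc _ h1) (inc _ h2) (inc _ h3) (inc _ h4)
  -- (4c) at `(⟨y, μ⟩ : PBond P (j + 1))` and at `(⟨y, μ⟩ : PBond P (j + 1))′`
  have hDc := norm_transported_comb_sub_main_le hj hj2 (⟨y, μ⟩ : PBond P (j + 1)) (Uc := Uc) (U := U) (A := A) hη.le hξ ha0 hα
    (fun b h1 h2 => hf b (incC _ h1) (incC _ h2)) (fun b h1 h2 => hA b (incC _ h1) (incC _ h2)) hηa (fun b h1 h2 => hU1 b (incC _ h1) (incC _ h2))
    (plaqOf (⟨y, μ⟩ : PBond P (j + 1)) incC) hRt2 hℓ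
  dsimp only [PBond.tgt] at hDc
  have hDc' := norm_transported_comb_sub_main_le hj hj2 (⟨y.shift ν, μ⟩ : PBond P (j + 1)) (Uc := Uc) (U := U) (A := A) hη.le hξ ha0 hα
    (fun b h1 h2 => hf b (incC' _ h1) (incC' _ h2)) (fun b h1 h2 => hA b (incC' _ h1) (incC' _ h2)) hηa (fun b h1 h2 => hU1 b (incC' _ h1) (incC' _ h2))
    (plaqOf (⟨y.shift ν, μ⟩ : PBond P (j + 1)) incC') hRt2 hℓ
  dsimp only [PBond.tgt] at hDc'
  -- the main term (4b)
  have hMT := norm_bondAvg_adJ_axialT_shift_sub_le hj hj2 y μ ν (U := U) (A := A) hη ha0 ha1 hα hU1 hplaq hA hA1 hRt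
  -- the pair-box cut-off: `(axialT U (emb y))` on the pair blocks, `U^{(axialT U (emb y))}` within `t` there, the cut-off-after-gauging field `W₀`
  let χ : PBond P j → Prop := fun b =>
    (blockOf b.src = y ∨ blockOf b.src = y.shift μ ∨ blockOf b.src = y.shift ν ∨ blockOf b.src = (y.shift μ).shift ν) ∧
    (blockOf b.tgt = y ∨ blockOf b.tgt = y.shift μ ∨ blockOf b.tgt = y.shift ν ∨ blockOf b.tgt = (y.shift μ).shift ν)
  let U' : GaugeField P j (Matrix n n ℂ)ˣ := fun b => if χ b then U b else 1
  have hU'U : ∀ b : PBond P j, (blockOf b.src = y ∨ blockOf b.src = y.shift μ ∨ blockOf b.src = y.shift ν ∨ blockOf b.src = (y.shift μ).shift ν) →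
      (blockOf b.tgt = y ∨ blockOf b.tgt = y.shift μ ∨ blockOf b.tgt = y.shift ν ∨ blockOf b.tgt = (y.shift μ).shift ν) → U' b = U b :=
    fun b h1 h2 => by simp only [U', χ, if_pos (And.intro h1 h2)]
  have hU'1 : ∀ b, U' b ∈ U1 (Matrix n n ℂ) := fun b => by
    by_cases hb : χ b
    · simp only [U', if_pos hb]; exact hU1 b hb.1 hb.2
    · simp only [U', if_neg hb]; exact (U1 _).one_mem
  have hplaq' : ∀ p : Plaq P j, (blockOf p.src = y ∨ blockOf p.src = y.shift μ ∨ blockOf p.src = y.shift ν ∨ blockOf p.src = (y.shift μ).shift ν) →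
      (blockOf (p.src.shift p.μ) = y ∨ blockOf (p.src.shift p.μ) = y.shift μ ∨ blockOf (p.src.shift p.μ) = y.shift ν ∨
        blockOf (p.src.shift p.μ) = (y.shift μ).shift ν) →
      (blockOf (p.src.shift p.ν) = y ∨ blockOf (p.src.shift p.ν) = y.shift μ ∨ blockOf (p.src.shift p.ν) = y.shift ν ∨
        blockOf (p.src.shift p.ν) = (y.shift μ).shift ν) →
      (blockOf ((p.src.shift p.μ).shift p.ν) = y ∨ blockOf ((p.src.shift p.μ).shift p.ν) = y.shift μ ∨
        blockOf ((p.src.shift p.μ).shift p.ν) = y.shift ν ∨ blockOf ((p.src.shift p.μ).shift p.ν) = (y.shift μ).shift ν) →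
      ‖((plaq U' p : (Matrix n n ℂ)ˣ) : Matrix n n ℂ) - 1‖ ≤ α := fun p c1 c2 c3 c4 => by
    have hpe : plaq U' p = plaq U p := by
      rw [plaq_eq, plaq_eq, hU'U ⟨p.src, p.μ⟩ c1 c2, hU'U ⟨p.src.shift p.μ, p.ν⟩ c2 c4, hU'U ⟨p.src, p.ν⟩ c1 c3,
        hU'U ⟨p.src.shift p.ν, p.μ⟩ c3 (by rw [PBond.tgt, Site.shift_comm]; exact c4)]
    rw [hpe]; exact hplaq p c1 c2 c3 c4
  have hvv' : ∀ x : Site P j, (blockOf x = y ∨ blockOf x = y.shift μ ∨ blockOf x = y.shift ν ∨ blockOf x = (y.shift μ).shift ν) →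
      (axialT U (emb y)) x = axialT U' (emb y) x := fun x hx => (axialT_congr_of_pairBlocks hj hj2 y μ ν hU'U hx).symm
  have hv1 : ∀ x : Site P j, (blockOf x = y ∨ blockOf x = y.shift μ ∨ blockOf x = y.shift ν ∨ blockOf x = (y.shift μ).shift ν) →
      (axialT U (emb y)) x ∈ U1 (Matrix n n ℂ) := fun x hx => by rw [hvv' x hx]; exact axialT_mem_U1 hU'1 _ x
  have hV₀ : ∀ b : PBond P j, (blockOf b.src = y ∨ blockOf b.src = y.shift μ ∨ blockOf b.src = y.shift ν ∨ blockOf b.src = (y.shift μ).shift ν) →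
      (blockOf b.tgt = y ∨ blockOf b.tgt = y.shift μ ∨ blockOf b.tgt = y.shift ν ∨ blockOf b.tgt = (y.shift μ).shift ν) →
      gaugeU (axialT U (emb y)) U b ∈ U1 (Matrix n n ℂ) ∧ ‖((gaugeU (axialT U (emb y)) U b : (Matrix n n ℂ)ˣ) : Matrix n n ℂ) - 1‖ ≤ t := fun b h1 h2 => by
    have heq : gaugeU (axialT U (emb y)) U b = gaugeU (axialT U' (emb y)) U' b := by
      simp only [gaugeU, hvv' b.src h1, hvv' b.tgt h2, hU'U b h1 h2]
    rw [heq]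
    refine ⟨(U1 _).mul_mem ((U1 _).mul_mem (axialT_mem_U1 hU'1 _ _) (hU'1 b)) ((U1 _).inv_mem (axialT_mem_U1 hU'1 _ _)), ?_⟩
    exact (norm_gaugeU_axialT_sub_one_le_of_pairBlocks hj hj2 hU'1 y μ ν hα hplaq' b h1 h2).trans hRt
  let W₀ : GaugeField P j (Matrix n n ℂ)ˣ := fun b => if χ b then gaugeU (axialT U (emb y)) U b else 1
  have hW₀1 : ∀ b, W₀ b ∈ U1 (Matrix n n ℂ) := fun b => by
    by_cases hb : χ b
    · simp only [W₀, if_pos hb]; exact (hV₀ b hb.1 hb.2).1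
    · simp only [W₀, if_neg hb]; exact (U1 _).one_mem
  have hW₀t : ∀ b, ‖((W₀ b : (Matrix n n ℂ)ˣ) : Matrix n n ℂ) - 1‖ ≤ t := fun b => by
    by_cases hb : χ b
    · simp only [W₀, if_pos hb]; exact (hV₀ b hb.1 hb.2).2
    · simp only [W₀, if_neg hb, Units.val_one, sub_self, norm_zero]; exact ht0
  -- `Ū(U)(y,ν) = E_ν·(axialT U (emb y) (emb (y.shift ν)))` with `(axialT U (emb y) (emb (y.shift ν))) = (axialT U (emb y))(emb(y + e_ν))`, `‖E_ν − 1‖ ≤ 17ℓt` (two-block locality for the bond `⟨y, ν⟩`)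
  have hctr' : blockOf (emb (y.shift ν)) = y.shift ν := Site.blockOf_emb hj _
  have hg1 : (axialT U (emb y) (emb (y.shift ν))) ∈ U1 (Matrix n n ℂ) := hv1 _ (Or.inr (Or.inr (Or.inl hctr')))
  let Uν : GaugeField P j (Matrix n n ℂ)ˣ := fun b =>
    if (blockOf b.src = y ∨ blockOf b.src = y.shift ν) ∧ (blockOf b.tgt = y ∨ blockOf b.tgt = y.shift ν) then U b else 1
  have hUνU : ∀ b : PBond P j, (blockOf b.src = (⟨y, ν⟩ : PBond P (j + 1)).src ∨ blockOf b.src = (⟨y, ν⟩ : PBond P (j + 1)).tgt) →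
      (blockOf b.tgt = (⟨y, ν⟩ : PBond P (j + 1)).src ∨ blockOf b.tgt = (⟨y, ν⟩ : PBond P (j + 1)).tgt) → Uν b = U b := fun b h1 h2 => by
    have hb : (blockOf b.src = y ∨ blockOf b.src = y.shift ν) ∧ (blockOf b.tgt = y ∨ blockOf b.tgt = y.shift ν) := ⟨h1, h2⟩
    simp only [Uν, if_pos hb]
  have hUν1 : ∀ b, Uν b ∈ U1 (Matrix n n ℂ) := fun b => by
    by_cases hb : (blockOf b.src = y ∨ blockOf b.src = y.shift ν) ∧ (blockOf b.tgt = y ∨ blockOf b.tgt = y.shift ν)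
    · simp only [Uν, if_pos hb]; exact hU1 b (incN _ hb.1) (incN _ hb.2)
    · simp only [Uν, if_neg hb]; exact (U1 _).one_mem
  have hvν : ∀ x : Site P j, (blockOf x = (⟨y, ν⟩ : PBond P (j + 1)).src ∨ blockOf x = (⟨y, ν⟩ : PBond P (j + 1)).tgt) →
      (axialT U (emb y)) x = axialT Uν (emb y) x := fun x hx => (axialT_congr_of_twoBlock hj hj2 ⟨y, ν⟩ hUνU hx).symm
  have hVν : ∀ b : PBond P j, (blockOf b.src = (⟨y, ν⟩ : PBond P (j + 1)).src ∨ blockOf b.src = (⟨y, ν⟩ : PBond P (j + 1)).tgt) →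
      (blockOf b.tgt = (⟨y, ν⟩ : PBond P (j + 1)).src ∨ blockOf b.tgt = (⟨y, ν⟩ : PBond P (j + 1)).tgt) →
      ‖((gaugeU (axialT Uν (emb y)) Uν b : (Matrix n n ℂ)ˣ) : Matrix n n ℂ) - 1‖ ≤ t := fun b h1 h2 => by
    have heq : gaugeU (axialT Uν (emb y)) Uν b = gaugeU (axialT U (emb y)) U b := by
      simp only [gaugeU, hvν b.src h1, hvν b.tgt h2, hUνU b h1 h2]
    rw [heq]; exact (hV₀ b (incN _ h1) (incN _ h2)).2
  have h17 := (norm_emlAvgU_sub_one_sub_linAvg_le hj (S := gaugeU (axialT Uν (emb y)) Uν) ⟨y, ν⟩ ht0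
    (by nlinarith only [hℓt, mul_nonneg hℓ0 ht0]) hVν).2
  set Eν : (Matrix n n ℂ)ˣ := avgUnits (gaugeU (axialT Uν (emb y)) Uν) ⟨y, ν⟩ with hEν
  change ‖(Eν : Matrix n n ℂ) - 1‖ ≤ 17 * ℓ * t at h17
  have hUAν_eq : avgUnits U ⟨y, ν⟩ = Eν * (axialT U (emb y) (emb (y.shift ν))) := by
    have hcov := avgUnits_gaugeU (axialT Uν (emb y)) Uν
    have hloc : avgUnits Uν ⟨y, ν⟩ = avgUnits U ⟨y, ν⟩ := emlAvgU_congr₂ hj ⟨y, ν⟩ hUνU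
    have hE' : Eν = axialT Uν (emb y) (emb y) * avgUnits U ⟨y, ν⟩ * (axialT Uν (emb y) (emb (y.shift ν)))⁻¹ := by
      rw [hEν, hcov]; simp only [gaugeU, hloc]; rfl
    rw [hE', axialT_self, one_mul, hvν _ (Or.inr hctr'), inv_mul_cancel_right]
  -- the base change of the block means at `(⟨y, μ⟩ : PBond P (j + 1))′`: `(axialT U (emb y) (emb (y.shift ν)))·Q(Ad((axialT U (emb y))′)A)((⟨y, μ⟩ : PBond P (j + 1))′)·(axialT U (emb y) (emb (y.shift ν)))⁻¹` vs `Q(Ad((axialT U (emb y)))A)((⟨y, μ⟩ : PBond P (j + 1))′)`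
  have hu'1 : ∀ x : Site P j, (blockOf x = (y.shift ν) ∨ blockOf x = ((y.shift ν).shift μ)) → (axialT U (emb (y.shift ν))) x ∈ U1 (Matrix n n ℂ) := fun x hx => by
    rw [axialT_congr_of_twoBlock hj hj2 (⟨y.shift ν, μ⟩ : PBond P (j + 1)) (V' := U') (fun b h1 h2 => (hU'U b (incC' _ h1) (incC' _ h2)).symm) hx]
    exact axialT_mem_U1 hU'1 _ _
  have hQle : ‖(bondAvg (adJ (axialT U (emb (y.shift ν))) A) (⟨y.shift ν, μ⟩ : PBond P (j + 1)))‖ ≤ a := by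
    let Yb : PBond P j → Matrix n n ℂ := fun b => if (blockOf b.src = (y.shift ν) ∨ blockOf b.src = ((y.shift ν).shift μ)) ∧ (blockOf b.tgt = (y.shift ν) ∨ blockOf b.tgt = ((y.shift ν).shift μ))
      then adJ (axialT U (emb (y.shift ν))) A b else 0
    have hY : ∀ b, ‖Yb b‖ ≤ a := fun b => by
      by_cases hb : (blockOf b.src = (y.shift ν) ∨ blockOf b.src = ((y.shift ν).shift μ)) ∧ (blockOf b.tgt = (y.shift ν) ∨ blockOf b.tgt = ((y.shift ν).shift μ))
      · simp only [Yb, if_pos hb, adJ]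
        exact (norm_units_conj_le (hu'1 b.src hb.1) _).trans (hA b (incC' _ hb.1) (incC' _ hb.2))
      · simp only [Yb, if_neg hb, norm_zero]; exact ha0
    have hQY : (bondAvg (adJ (axialT U (emb (y.shift ν))) A) (⟨y.shift ν, μ⟩ : PBond P (j + 1))) = bondAvg Yb (⟨y.shift ν, μ⟩ : PBond P (j + 1)) := bondAvg_congr₂ hj (⟨y.shift ν, μ⟩ : PBond P (j + 1)) fun b h1 h2 => by
      have hb : (blockOf b.src = (y.shift ν) ∨ blockOf b.src = ((y.shift ν).shift μ)) ∧ (blockOf b.tgt = (y.shift ν) ∨ blockOf b.tgt = ((y.shift ν).shift μ)) := ⟨h1, h2⟩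
      simp only [Yb, if_pos hb]
    rw [hQY]; exact norm_bondAvg_le_of_bound Yb hY (⟨y.shift ν, μ⟩ : PBond P (j + 1))
  -- `H_x = (axialT U (emb y) (emb (y.shift ν)))·(axialT U (emb y))′(x)·(axialT U (emb y))(x)⁻¹` is within `(ℓ/2)t` of `1` on the two blocks of `(⟨y, μ⟩ : PBond P (j + 1))′`
  have hH : ∀ x : Site P j, (blockOf x = (y.shift ν) ∨ blockOf x = ((y.shift ν).shift μ)) →
      (axialT U (emb y) (emb (y.shift ν))) * (axialT U (emb (y.shift ν))) x * ((axialT U (emb y)) x)⁻¹ ∈ U1 (Matrix n n ℂ) ∧ ‖(((axialT U (emb y) (emb (y.shift ν))) * (axialT U (emb (y.shift ν))) x * ((axialT U (emb y)) x)⁻¹ : (Matrix n n ℂ)ˣ) : Matrix n n ℂ) - 1‖ ≤ ℓ / 2 * t := fun x hx => by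
    refine ⟨(U1 _).mul_mem ((U1 _).mul_mem hg1 (hu'1 x hx)) ((U1 _).inv_mem (hv1 x (incC' _ hx))), ?_⟩
    have hHeq : holT W₀ (emb (y.shift ν)) (treeWord (rel (emb (y.shift ν)) x)) = (axialT U (emb y) (emb (y.shift ν))) * (axialT U (emb (y.shift ν))) x * ((axialT U (emb y)) x)⁻¹ := by
      have hloc : holT W₀ (emb (y.shift ν)) (treeWord (rel (emb (y.shift ν)) x)) =
          holT (gaugeU (axialT U (emb y)) U) (emb (y.shift ν)) (treeWord (rel (emb (y.shift ν)) x)) := by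
        have := axialT_congr_of_twoBlock hj hj2 (⟨y.shift ν, μ⟩ : PBond P (j + 1)) (V := W₀) (V' := gaugeU (axialT U (emb y)) U) (fun b h1 h2 => ?_) hx
        · simpa only [axialT] using this
        have hb : χ b := ⟨incC' _ h1, incC' _ h2⟩
        simp only [W₀, if_pos hb]
      rw [hloc, holT_gaugeU_treeWord_eq]
    rw [← hHeq]
    refine (norm_holT_sub_one_le_length_mul hW₀1 ht0 hW₀t _ _).trans ?_
    rw [B7Prop1Explicit.length_treeWord]
    have hin := inBox_rel_of_twoBlock hj hj2 (⟨y.shift ν, μ⟩ : PBond P (j + 1)) hx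
    have h2l : (2 : ℝ) * ((l1 (rel (emb (y.shift ν)) x) : ℕ) : ℝ) ≤ ℓ := by
      rw [hℓdef]; exact_mod_cast two_mul_l1_le_of_inBox (⟨y.shift ν, μ⟩ : PBond P (j + 1)) (fun κ => hin κ)
    nlinarith only [h2l, ht0]
  have hBC' : ‖(((axialT U (emb y) (emb (y.shift ν))) : (Matrix n n ℂ)ˣ) : Matrix n n ℂ) * (bondAvg (adJ (axialT U (emb (y.shift ν))) A) (⟨y.shift ν, μ⟩ : PBond P (j + 1))) * (((axialT U (emb y) (emb (y.shift ν)))⁻¹ : (Matrix n n ℂ)ˣ) : Matrix n n ℂ) - (bondAvg (adJ (axialT U (emb y)) A) (⟨y.shift ν, μ⟩ : PBond P (j + 1)))‖ ≤ ℓ * t * a := by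
    let D : PBond P j → Matrix n n ℂ := fun b => if (blockOf b.src = (y.shift ν) ∨ blockOf b.src = ((y.shift ν).shift μ)) ∧ (blockOf b.tgt = (y.shift ν) ∨ blockOf b.tgt = ((y.shift ν).shift μ))
      then (((axialT U (emb y) (emb (y.shift ν))) : (Matrix n n ℂ)ˣ) : Matrix n n ℂ) * adJ (axialT U (emb (y.shift ν))) A b * (((axialT U (emb y) (emb (y.shift ν)))⁻¹ : (Matrix n n ℂ)ˣ) : Matrix n n ℂ) - adJ (axialT U (emb y)) A b else 0
    have hD : ∀ b, ‖D b‖ ≤ ℓ * t * a := fun b => by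
      by_cases hb : (blockOf b.src = (y.shift ν) ∨ blockOf b.src = ((y.shift ν).shift μ)) ∧ (blockOf b.tgt = (y.shift ν) ∨ blockOf b.tgt = ((y.shift ν).shift μ))
      · simp only [D, if_pos hb]
        set Hx : (Matrix n n ℂ)ˣ := (axialT U (emb y) (emb (y.shift ν))) * (axialT U (emb (y.shift ν))) b.src * ((axialT U (emb y)) b.src)⁻¹ with hHx
        have hgv : (axialT U (emb y) (emb (y.shift ν))) * (axialT U (emb (y.shift ν))) b.src = Hx * (axialT U (emb y)) b.src := by rw [hHx]; group
        have hid0 : (((axialT U (emb y) (emb (y.shift ν))) : (Matrix n n ℂ)ˣ) : Matrix n n ℂ) * adJ (axialT U (emb (y.shift ν))) A b * (((axialT U (emb y) (emb (y.shift ν)))⁻¹ : (Matrix n n ℂ)ˣ) : Matrix n n ℂ) =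
            (Hx : Matrix n n ℂ) * adJ (axialT U (emb y)) A b * ((Hx⁻¹ : (Matrix n n ℂ)ˣ) : Matrix n n ℂ) := by
          have e1 : (((axialT U (emb y) (emb (y.shift ν))) : (Matrix n n ℂ)ˣ) : Matrix n n ℂ) * adJ (axialT U (emb (y.shift ν))) A b * (((axialT U (emb y) (emb (y.shift ν)))⁻¹ : (Matrix n n ℂ)ˣ) : Matrix n n ℂ) =
              ((((axialT U (emb y) (emb (y.shift ν))) * (axialT U (emb (y.shift ν))) b.src : (Matrix n n ℂ)ˣ)) : Matrix n n ℂ) * A b * (((((axialT U (emb y) (emb (y.shift ν))) * (axialT U (emb (y.shift ν))) b.src)⁻¹ : (Matrix n n ℂ)ˣ)) : Matrix n n ℂ) := by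
            simp only [adJ, mul_inv_rev, Units.val_mul]; noncomm_ring
          have e2 : (Hx : Matrix n n ℂ) * adJ (axialT U (emb y)) A b * ((Hx⁻¹ : (Matrix n n ℂ)ˣ) : Matrix n n ℂ) =
              (((Hx * (axialT U (emb y)) b.src : (Matrix n n ℂ)ˣ)) : Matrix n n ℂ) * A b * ((((Hx * (axialT U (emb y)) b.src)⁻¹ : (Matrix n n ℂ)ˣ)) : Matrix n n ℂ) := by
            simp only [adJ, mul_inv_rev, Units.val_mul]; noncomm_ring
          rw [e1, e2, hgv]
        rw [hid0]
        obtain ⟨hHU, hHt⟩ := hH b.src hb.1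
        calc ‖(Hx : Matrix n n ℂ) * adJ (axialT U (emb y)) A b * ((Hx⁻¹ : (Matrix n n ℂ)ˣ) : Matrix n n ℂ) - adJ (axialT U (emb y)) A b‖ ≤ 2 * ‖(Hx : Matrix n n ℂ) - 1‖ * ‖adJ (axialT U (emb y)) A b‖ :=
              norm_conj_sub_le_of_U1 hHU _
          _ ≤ 2 * (ℓ / 2 * t) * a := by
              have hZ : ‖adJ (axialT U (emb y)) A b‖ ≤ a := (norm_units_conj_le (hv1 b.src (incC' _ hb.1)) _).trans (hA b (incC' _ hb.1) (incC' _ hb.2))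
              have : 0 ≤ ‖(Hx : Matrix n n ℂ) - 1‖ := norm_nonneg _
              nlinarith only [hZ, hHt, this, norm_nonneg (adJ (axialT U (emb y)) A b)]
          _ = ℓ * t * a := by ring
      · simp only [D, if_neg hb, norm_zero]; positivity
    have hdiff : (((axialT U (emb y) (emb (y.shift ν))) : (Matrix n n ℂ)ˣ) : Matrix n n ℂ) * (bondAvg (adJ (axialT U (emb (y.shift ν))) A) (⟨y.shift ν, μ⟩ : PBond P (j + 1))) * (((axialT U (emb y) (emb (y.shift ν)))⁻¹ : (Matrix n n ℂ)ˣ) : Matrix n n ℂ) - (bondAvg (adJ (axialT U (emb y)) A) (⟨y.shift ν, μ⟩ : PBond P (j + 1))) = bondAvg D (⟨y.shift ν, μ⟩ : PBond P (j + 1)) := by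
      rw [← bondAvg_units_conj]
      have hsub : bondAvg (fun b => (((axialT U (emb y) (emb (y.shift ν))) : (Matrix n n ℂ)ˣ) : Matrix n n ℂ) * adJ (axialT U (emb (y.shift ν))) A b * (((axialT U (emb y) (emb (y.shift ν)))⁻¹ : (Matrix n n ℂ)ˣ) : Matrix n n ℂ)) (⟨y.shift ν, μ⟩ : PBond P (j + 1)) - bondAvg (adJ (axialT U (emb y)) A) (⟨y.shift ν, μ⟩ : PBond P (j + 1)) =
          bondAvg (fun b => (((axialT U (emb y) (emb (y.shift ν))) : (Matrix n n ℂ)ˣ) : Matrix n n ℂ) * adJ (axialT U (emb (y.shift ν))) A b * (((axialT U (emb y) (emb (y.shift ν)))⁻¹ : (Matrix n n ℂ)ˣ) : Matrix n n ℂ) - adJ (axialT U (emb y)) A b) (⟨y.shift ν, μ⟩ : PBond P (j + 1)) := by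
        simp only [bondAvg, segSum, Finset.sum_sub_distrib, smul_sub]
      rw [hsub]
      refine bondAvg_congr₂ hj (⟨y.shift ν, μ⟩ : PBond P (j + 1)) fun b h1 h2 => ?_
      have hb : (blockOf b.src = (y.shift ν) ∨ blockOf b.src = ((y.shift ν).shift μ)) ∧ (blockOf b.tgt = (y.shift ν) ∨ blockOf b.tgt = ((y.shift ν).shift μ)) := ⟨h1, h2⟩
      simp only [D, if_pos hb]
    rw [hdiff]
    exact norm_bondAvg_le_of_bound D hD (⟨y.shift ν, μ⟩ : PBond P (j + 1))
  -- assemble the covariant difference quotient: `∇^ξ(W⟨·,μ⟩)(y) = ξ⁻¹·(U_A(y,ν)·W((⟨y, μ⟩ : PBond P (j + 1))′)·U_A(y,ν)⁻¹ − W((⟨y, μ⟩ : PBond P (j + 1))))`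
  unfold nabla
  dsimp only
  rw [norm_smul, norm_inv, Complex.norm_real, Real.norm_of_nonneg hξ.le]
  refine mul_le_mul_of_nonneg_left ?_ (inv_nonneg.mpr hξ.le)
  -- abstract the four matrices `W(c), W(c′), M(c), M(c′)`
  generalize hWdef : ((I * (ξ : ℂ))⁻¹ • mlog (((avgUnits Uc ⟨y, μ⟩ : (Matrix n n ℂ)ˣ) : Matrix n n ℂ) * (((avgUnits U ⟨y, μ⟩)⁻¹ : (Matrix n n ℂ)ˣ) : Matrix n n ℂ)) +
          ((η / ξ : ℝ) : ℂ) • (((avgUnits U ⟨y, μ⟩ : (Matrix n n ℂ)ˣ) : Matrix n n ℂ) * combMean (adJ (axialT U (emb (y.shift μ))) A) (y.shift μ) *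
            (((avgUnits U ⟨y, μ⟩)⁻¹ : (Matrix n n ℂ)ˣ) : Matrix n n ℂ) - combMean (adJ (axialT U (emb y)) A) y)) = W at hDc ⊢
  generalize hW'def : ((I * (ξ : ℂ))⁻¹ • mlog (((avgUnits Uc ⟨y.shift ν, μ⟩ : (Matrix n n ℂ)ˣ) : Matrix n n ℂ) * (((avgUnits U ⟨y.shift ν, μ⟩)⁻¹ : (Matrix n n ℂ)ˣ) : Matrix n n ℂ)) +
          ((η / ξ : ℝ) : ℂ) • (((avgUnits U ⟨y.shift ν, μ⟩ : (Matrix n n ℂ)ˣ) : Matrix n n ℂ) * combMean (adJ (axialT U (emb ((y.shift ν).shift μ))) A) ((y.shift ν).shift μ) *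
            (((avgUnits U ⟨y.shift ν, μ⟩)⁻¹ : (Matrix n n ℂ)ˣ) : Matrix n n ℂ) - combMean (adJ (axialT U (emb (y.shift ν))) A) (y.shift ν))) = W' at hDc' ⊢
  generalize hMdef : (((η / ξ : ℝ) : ℂ) • (((P.L : ℕ) : ℂ) • bondAvg (adJ (axialT U (emb y)) A) (⟨y, μ⟩ : PBond P (j + 1)))) = M at hDc
  generalize hM'def : (((η / ξ : ℝ) : ℂ) • (((P.L : ℕ) : ℂ) • bondAvg (adJ (axialT U (emb (y.shift ν))) A) (⟨y.shift ν, μ⟩ : PBond P (j + 1)))) = M' at hDc'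
  -- the main block
  have hmainQ := norm_conj_factor_sub_le hUAν_eq h17 (by nlinarith only [hℓt, mul_nonneg hℓ0 ht0]) hg1 (bondAvg (adJ (axialT U (emb (y.shift ν))) A) (⟨y.shift ν, μ⟩ : PBond P (j + 1))) (bondAvg (adJ (axialT U (emb y)) A) (⟨y.shift ν, μ⟩ : PBond P (j + 1))) (bondAvg (adJ (axialT U (emb y)) A) (⟨y, μ⟩ : PBond P (j + 1))) hQle hBC' hMT
  have hηξ : 0 ≤ η / ξ := div_nonneg hη.le hξ.le
  have hmain : ‖((avgUnits U ⟨y, ν⟩ : (Matrix n n ℂ)ˣ) : Matrix n n ℂ) * M' * (((avgUnits U ⟨y, ν⟩)⁻¹ : (Matrix n n ℂ)ˣ) : Matrix n n ℂ) - M‖ ≤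
      η / ξ * (P.L : ℝ) * (69 * ℓ * t * a + (P.L : ℝ) * (η * a₁ + 2 * t * a)) := by
    rw [← hMdef, ← hM'def, conj_smul_smul_sub, norm_smul, norm_smul, Complex.norm_real, Complex.norm_natCast, Real.norm_of_nonneg hηξ, ← mul_assoc]
    refine mul_le_mul_of_nonneg_left (hmainQ.trans (le_of_eq (by ring))) (by positivity)
  have key := norm_conj_sub_le_split hUAν W W' M M' hDc hDc' hmain
  refine key.trans (le_of_eq ?_)
  rw [hℓdef]
  ring

end YMDAG.N18.TransportOfRecord

end
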